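import Literature.Topology.FourManifolds.OrientationCharacterLocal
import Literature.Topology.FourManifolds.ZeroSphereSurgeryNeckPolar
import HarnessLib

/-!
# The two feet of a `0`-surgery with orientable result have opposite orientation characters

Topic `Literature/Topology/FourManifolds`; the ORIENTABILITY OBSTRUCTION in the one-handle step
(A. A. Kosinski, *Differential Manifolds* (1993), VI (6.6): *"if `Dᵐ ∪ H¹` is orientable, then it
is diffeomorphic to `S¹ × D^{m-1}`"* — the `1`-handle must be attached with the two feet
oppositely oriented, otherwise the result contains a solid Klein bottle; on the boundary: the
`0`-surgery `S⁰ × D³ ↝ D¹ × S²` of a `3`-manifold along a framed `S⁰` whose two feet induce the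
SAME orientation produces the non-orientable `S²`-bundle over `S¹`).  In the relational language
of the tree (`FramedSphereFamily.IsSurgery`, `ballTimesSphere Unit 0 2`, `SphereFamilySurgery.lean`;
the normalised relation `stdRel` of `ZeroSphereSurgeryModelGluing.lean`):

**Theorem** (`orientPosAt_foot_iff_not`).  Let `P` be a `3`-manifold glued from an open
submanifold `A ⊆ Z` of a `3`-manifold (embedding `jA : A ↪ P`) and the neck
`D̊¹ × S²` (embedding `jB`), in such a way that for two maps `F₊, F₋ : ℝ³ → Z`, smooth on the
punctured unit ball with values in `A`, the identifications `jA (F₊ (t u)) = jB (t e₁, u)` and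
`jA (F₋ (t u)) = jB (-t e₁, u)` hold (`0 < t < 1`, `u ∈ S²`) — as they do for the two feet
`F± = νS(±e₁, ·)` of Milnor's identification along a framed `S⁰`, and for `F₊ = D₊`,
`F₋ = D₋ ∘ ρ` in `stdRel D₊ D₋`.  Then for every orientation `o` of `P` the maps `jA ∘ F₊` and
`jA ∘ F₋` have OPPOSITE orientation characters at any two points of the punctured unit ball.

**Corollary** (`not_smoothOrientation_of_reflected_foot`).  If the two feet lie in one disc
`C : ℝ³ ↪ Z`, `F₊ = C ∘ d₊`, `F₋ = C ∘ d₋ ∘ ρ` with `det d(d₊) < 0 < det d(d₋)` on the punctured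
unit ball and `ρ` a linear isometry of negative determinant, then `P` is NOT orientable (the
character of `jA ∘ C` is constant on the connected `ℝ³ ∖ {d₊ 0, d₋ 0}` and both feet have the
character opposite to it).  This is the case excluded by the orientability hypothesis in the
one-handle step (Kosinski 1993, VI (6.6)).

## Proof

The shell `V = {0 < ‖v‖ < 2} ⊆ ℝ³` parametrises the whole neck by `v ↦ jB ((‖v‖ - 1) e₁, v/‖v‖)`
(`neckPolar`), a local diffeomorphism `k` into `P` (its differential is injective: `neckPolar` has
the smooth left inverse `(y, u) ↦ (y + 1) u` and `jB` is an immersion), so the orientation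
character of `k` is constant on the connected `V` (`orientPosAt_iff_of_isPreconnected`).  On the
outer shell `1 < ‖v‖ < 2` the identification gives `k = (jA ∘ F₊) ∘ m₊` with the shell shift
`m₊ v = (1 - ‖v‖⁻¹) v`, whose Jacobian determinant `(1 - ‖v‖⁻¹)² > 0` is computed by the matrix
determinant lemma (`det_smul_id_add_smulRight`); on the inner punctured ball `0 < ‖v‖ < 1` it
gives `k = (jA ∘ F₋) ∘ ψ` with Kervaire–Milnor's disc inversion `ψ v = (1 - ‖v‖) v/‖v‖`, of
NEGATIVE Jacobian determinant (`det_fderiv_discInversionFun_neg`).  The parity rule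
`orientPosAt_comp_iff` converts the constancy of the character of `k` across the core sphere
`‖v‖ = 1` into the opposition of the characters of `jA ∘ F₊` and `jA ∘ F₋`.

Everything here is proved; no named facts are introduced.

## References

* A. A. Kosinski, *Differential Manifolds* (1993), VI (6.6) and VI §9. [Kosinski1993]
* M. W. Hirsch, *Differential Topology*, GTM 33 (1976), Ch. 4 §4, p. 101. [HirschDT1976]
* M. Kervaire, J. Milnor, *Groups of homotopy spheres I*, Ann. of Math. 77 (1963), §2 (the disc
  inversion is orientation reversing). [KervaireMilnorAnnals1963]
-/

open scoped Manifold ContDiff Topology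
open Set Function Filter Module Metric

noncomputable section

namespace Literature.Topology.FourManifolds

/-- Local notation: `𝔼 n` is the model Euclidean space `EuclideanSpace ℝ (Fin n)`. -/
local notation "𝔼 " n:arg => EuclideanSpace ℝ (Fin n)

/-- Local notation: `𝕊 n` is the unit sphere in `EuclideanSpace ℝ (Fin (n + 1))`. -/
local notation "𝕊 " n:arg => (Metric.sphere (0 : EuclideanSpace ℝ (Fin (n + 1))) 1)

namespace ZeroSphereOrientation

open GluckUnknot (sphereProj coe_sphereProj sphereProj_smul_coe)

attribute [local instance] fact_finrank_euclideanSpace_succ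

/-! ### §4 The theorem -/

variable {Z : Type*} [TopologicalSpace Z] [ChartedSpace (𝔼 3) Z]
  {P : Type*} [TopologicalSpace P] [ChartedSpace (𝔼 3) P] [IsManifold (𝓡 3) ∞ P]

/-- **The two feet of a `0`-surgery with orientable result have opposite orientation characters**
(the orientability obstruction behind Kosinski 1993, VI (6.6); see the module docstring).  `A ⊆ Z`
open, `jA : A ↪ P` and `jB : D̊¹ × S² ↪ P` smooth embeddings into the `3`-manifold `P`;
`F₊, F₋ : ℝ³ → Z` smooth on the punctured unit ball with values in `A`, identified with the two
halves of the neck: `jA (F₊ (t u)) = jB ((), t e₁, u)`, `jA (F₋ (t u)) = jB ((), -t e₁, u)` for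
`0 < t < 1`, `u ∈ S²`.  Then for every orientation `o` of `P` (and any reference orientation `o₀`
of `ℝ³`, any filler `p₀`), `jA ∘ F₊` is orientation preserving at a point `w` of the punctured unit
ball iff `jA ∘ F₋` is orientation REVERSING at a point `w'` of it.
[cite: Kosinski1993, VI (6.6)] [cite: HirschDT1976, Ch. 4 §4, p. 101] -/
theorem orientPosAt_foot_iff_not (A : TopologicalSpace.Opens Z) {jA : A → P}
    (hA : Manifold.IsSmoothEmbedding (𝓡 3) (𝓡 3) ∞ jA) {jB : ↥(ballTimesSphere Unit 0 2) → P}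
    (hB : Manifold.IsSmoothEmbedding ((𝓡 0).prod ((𝓡 1).prod (𝓡 2))) (𝓡 3) ∞ jB)
    {Fp Fm : 𝔼 3 → Z}
    (hFp : ContMDiffOn 𝓘(ℝ, 𝔼 3) (𝓡 3) ∞ Fp {w | 0 < ‖w‖ ∧ ‖w‖ < 1})
    (hFm : ContMDiffOn 𝓘(ℝ, 𝔼 3) (𝓡 3) ∞ Fm {w | 0 < ‖w‖ ∧ ‖w‖ < 1})
    (hFpA : ∀ w : 𝔼 3, 0 < ‖w‖ → ‖w‖ < 1 → Fp w ∈ A)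
    (hFmA : ∀ w : 𝔼 3, 0 < ‖w‖ → ‖w‖ < 1 → Fm w ∈ A)
    (hp : ∀ (t : ℝ) (_ : t ∈ Ioo (0 : ℝ) 1) (u : 𝕊 2) (ha : Fp (t • (u : 𝔼 3)) ∈ A)
      (hb : ((DiscreteIndex.mk (), t • EuclideanSpace.single 0 1, u) :
        DiscreteIndex Unit × ((𝔼 1) × (𝕊 2))) ∈ ballTimesSphere Unit 0 2),
      jA ⟨Fp (t • (u : 𝔼 3)), ha⟩ = jB ⟨_, hb⟩)
    (hm : ∀ (t : ℝ) (_ : t ∈ Ioo (0 : ℝ) 1) (u : 𝕊 2) (ha : Fm (t • (u : 𝔼 3)) ∈ A)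
      (hb : ((DiscreteIndex.mk (), (-t) • EuclideanSpace.single 0 1, u) :
        DiscreteIndex Unit × ((𝔼 1) × (𝕊 2))) ∈ ballTimesSphere Unit 0 2),
      jA ⟨Fm (t • (u : 𝔼 3)), ha⟩ = jB ⟨_, hb⟩)
    (o₀ : Orientation ℝ (𝔼 3) (Fin (finrank ℝ (𝔼 3)))) (o : SmoothOrientation (𝓡 3) P) (p₀ : P)
    {w w' : 𝔼 3} (hw0 : 0 < ‖w‖) (hw1 : ‖w‖ < 1) (hw0' : 0 < ‖w'‖) (hw1' : ‖w'‖ < 1) :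
    OrientPosAt o₀ o (Function.extend Subtype.val jA (fun _ => p₀) ∘ Fp) w ↔ ¬ OrientPosAt o₀ o (Function.extend Subtype.val jA (fun _ => p₀) ∘ Fm) w' := by
  -- notation
  set gp : 𝔼 3 → P := Function.extend Subtype.val jA (fun _ => p₀) ∘ Fp with hgp
  set gm : 𝔼 3 → P := Function.extend Subtype.val jA (fun _ => p₀) ∘ Fm with hgm
  set jBe : DiscreteIndex Unit × ((𝔼 1) × (𝕊 2)) → P := Function.extend Subtype.val jB (fun _ => p₀)
    with hjBe
  set k : 𝔼 3 → P := jBe ∘ neckPolar with hk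
  set V : Set (𝔼 3) := {v | 0 < ‖v‖ ∧ ‖v‖ < 2} with hV
  have hVo : IsOpen V := by
    rw [hV, setOf_and]
    exact (isOpen_lt continuous_const continuous_norm).inter (isOpen_lt continuous_norm continuous_const)
  have hne : ∀ {v : 𝔼 3}, 0 < ‖v‖ → v ≠ 0 := fun h => norm_pos_iff.1 h
  ------------------------------------------------------------------------------------------
  -- Step 1: `k` is a local diffeomorphism on the shell `V`, so its character is constant there
  ------------------------------------------------------------------------------------------
  have hkat : ∀ v ∈ V, ContMDiffAt 𝓘(ℝ, 𝔼 3) (𝓡 3) ∞ k v := fun v hv =>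
    (contMDiffAt_extend_val p₀ hB.contMDiff (neckPolar_mem hv.1 hv.2)).comp v
      (contMDiffAt_neckPolar (hne hv.1))
  have hkon : ContMDiffOn 𝓘(ℝ, 𝔼 3) (𝓡 3) ∞ k V := fun v hv => (hkat v hv).contMDiffWithinAt
  have hkdet : ∀ v ∈ V, LinearMap.det (M := 𝔼 3) (mfderiv 𝓘(ℝ, 𝔼 3) (𝓡 3) k v).toLinearMap ≠ 0 :=
    fun v hv => by
    rw [hk, mfderiv_comp v ((contMDiffAt_extend_val p₀ hB.contMDiff (neckPolar_mem hv.1 hv.2)).mdifferentiableAt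
      (by simp)) ((contMDiffAt_neckPolar (hne hv.1)).mdifferentiableAt (by simp))]
    apply det_ne_zero_of_injective
    intro a b hab
    exact injective_mfderiv_neckPolar (hne hv.1)
      (injective_mfderiv_extend_val p₀ hB ⟨neckPolar v, neckPolar_mem hv.1 hv.2⟩ hab)
  have hkconst : ∀ {v v' : 𝔼 3}, v ∈ V → v' ∈ V → (OrientPosAt o₀ o k v ↔ OrientPosAt o₀ o k v') :=
    fun hv hv' => orientPosAt_iff_of_isPreconnected hVo (isPreconnected_shell 0 2 le_rfl) hkon hkdet hv hv'
  ------------------------------------------------------------------------------------------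
  -- Step 2: on the outer shell, `k = gp ∘ m₊`
  ------------------------------------------------------------------------------------------
  have hgpat : ∀ x : 𝔼 3, 0 < ‖x‖ → ‖x‖ < 1 → MDifferentiableAt 𝓘(ℝ, 𝔼 3) (𝓡 3) gp x :=
    fun x hx0 hx1 => by
    have h1 : ContMDiffAt 𝓘(ℝ, 𝔼 3) (𝓡 3) ∞ Fp x := hFp.contMDiffAt (by
      rw [setOf_and]
      exact ((isOpen_lt continuous_const continuous_norm).inter
        (isOpen_lt continuous_norm continuous_const)).mem_nhds ⟨hx0, hx1⟩)
    exact ((contMDiffAt_extend_val p₀ hA.contMDiff (hFpA x hx0 hx1)).comp x h1).mdifferentiableAt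
      (by simp)
  have hgmat : ∀ x : 𝔼 3, 0 < ‖x‖ → ‖x‖ < 1 → MDifferentiableAt 𝓘(ℝ, 𝔼 3) (𝓡 3) gm x :=
    fun x hx0 hx1 => by
    have h1 : ContMDiffAt 𝓘(ℝ, 𝔼 3) (𝓡 3) ∞ Fm x := hFm.contMDiffAt (by
      rw [setOf_and]
      exact ((isOpen_lt continuous_const continuous_norm).inter
        (isOpen_lt continuous_norm continuous_const)).mem_nhds ⟨hx0, hx1⟩)
    exact ((contMDiffAt_extend_val p₀ hA.contMDiff (hFmA x hx0 hx1)).comp x h1).mdifferentiableAt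
      (by simp)
  have hout_pt : ∀ v : 𝔼 3, 1 < ‖v‖ → ‖v‖ < 2 → k v = gp (shellShift v) := fun v hv1 hv2 => by
    have hv0 : 0 < ‖v‖ := by linarith
    have ht : ‖v‖ - 1 ∈ Ioo (0 : ℝ) 1 := ⟨by linarith, by linarith⟩
    have hb := neckPolar_mem hv0 hv2
    have hsx : shellShift v = (‖v‖ - 1) • (sphereProj v : 𝔼 3) := shellShift_eq_smul_sphereProj (hne hv0)
    have hns : ‖shellShift v‖ = ‖v‖ - 1 := norm_shellShift hv1.le
    have ha : Fp ((‖v‖ - 1) • (sphereProj v : 𝔼 3)) ∈ A := by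
      rw [← hsx]; exact hFpA _ (by rw [hns]; exact ht.1) (by rw [hns]; exact ht.2)
    have h1 : k v = jB ⟨(DiscreteIndex.mk (), (‖v‖ - 1) • EuclideanSpace.single 0 1, sphereProj v), hb⟩ :=
      extend_val_apply_of_mem jB p₀ hb
    have h2 : gp (shellShift v) = jA ⟨Fp (shellShift v), hsx ▸ ha⟩ := by
      rw [hgp, Function.comp_apply, extend_val_apply_of_mem]
    rw [h1, h2]
    have h3 := hp (‖v‖ - 1) ht (sphereProj v) ha hb
    rw [← h3]
    congr 1
    exact Subtype.ext (congrArg Fp hsx.symm)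
  have hout : ∀ v : 𝔼 3, 1 < ‖v‖ → ‖v‖ < 2 →
      (OrientPosAt o₀ o k v ↔ OrientPosAt o₀ o gp (shellShift v)) := fun v hv1 hv2 => by
    have hv0 : 0 < ‖v‖ := by linarith
    have hev : k =ᶠ[𝓝 v] gp ∘ shellShift := by
      have hop : IsOpen {x : 𝔼 3 | 1 < ‖x‖ ∧ ‖x‖ < 2} := by
        rw [setOf_and]
        exact (isOpen_lt continuous_const continuous_norm).inter
          (isOpen_lt continuous_norm continuous_const)
      filter_upwards [hop.mem_nhds ⟨hv1, hv2⟩] with x hx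
      exact hout_pt x hx.1 hx.2
    have hns : ‖shellShift v‖ = ‖v‖ - 1 := norm_shellShift hv1.le
    have hs0 : 0 < ‖shellShift v‖ := by rw [hns]; linarith
    have hs1 : ‖shellShift v‖ < 1 := by rw [hns]; linarith
    have hdiff := differentiableAt_shellShift (hne hv0)
    have hgpd := hgpat _ hs0 hs1
    have hdet : LinearMap.det (M := 𝔼 3) (mfderiv 𝓘(ℝ, 𝔼 3) (𝓡 3) (gp ∘ shellShift) v).toLinearMap ≠ 0 := by
      rw [← hev.mfderiv_eq]; exact hkdet v ⟨hv0, hv2⟩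
    obtain ⟨hdf, hdp⟩ := det_ne_zero_of_det_mfderiv_comp_ne_zero hdiff hgpd hdet
    rw [orientPosAt_congr_of_eventuallyEq hev, orientPosAt_comp_iff hdiff hgpd hdf hdp]
    exact iff_true_right (det_fderiv_shellShift_pos (hne hv0) (by linarith))
  ------------------------------------------------------------------------------------------
  -- Step 3: on the inner punctured ball, `k = gm ∘ ψ` with the disc inversion `ψ`
  ------------------------------------------------------------------------------------------
  have hin_pt : ∀ v : 𝔼 3, 0 < ‖v‖ → ‖v‖ < 1 → k v = gm (discInversionFun v) := fun v hv0 hv1 => by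
    have ht : 1 - ‖v‖ ∈ Ioo (0 : ℝ) 1 := ⟨by linarith, by linarith⟩
    have hb := neckPolar_mem hv0 (by linarith)
    have hsx : discInversionFun v = (1 - ‖v‖) • (sphereProj v : 𝔼 3) := by
      rw [discInversionFun, coe_sphereProj (hne hv0), NormedSpace.normalize, smul_smul]
    have hns : ‖discInversionFun v‖ = 1 - ‖v‖ := norm_discInversionFun (hne hv0) hv1.le
    have ha : Fm ((1 - ‖v‖) • (sphereProj v : 𝔼 3)) ∈ A := by
      rw [← hsx]; exact hFmA _ (by rw [hns]; exact ht.1) (by rw [hns]; exact ht.2)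
    have hb' : ((DiscreteIndex.mk (), (-(1 - ‖v‖)) • EuclideanSpace.single 0 1, sphereProj v) :
        DiscreteIndex Unit × ((𝔼 1) × (𝕊 2))) ∈ ballTimesSphere Unit 0 2 := by
      have : (-(1 - ‖v‖)) = ‖v‖ - 1 := by ring
      rw [this]; exact hb
    have h1 : k v = jB ⟨neckPolar v, hb⟩ := extend_val_apply_of_mem jB p₀ hb
    have h2 : gm (discInversionFun v) = jA ⟨Fm (discInversionFun v), hsx ▸ ha⟩ := by
      rw [hgm, Function.comp_apply, extend_val_apply_of_mem]
    rw [h1, h2]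
    have h3 := hm (1 - ‖v‖) ht (sphereProj v) ha hb'
    have h4 : (⟨neckPolar v, hb⟩ : ↥(ballTimesSphere Unit 0 2)) =
        ⟨(DiscreteIndex.mk (), (-(1 - ‖v‖)) • EuclideanSpace.single 0 1, sphereProj v), hb'⟩ := by
      apply Subtype.ext
      show neckPolar v = (DiscreteIndex.mk (), (-(1 - ‖v‖)) • EuclideanSpace.single 0 1, sphereProj v)
      rw [neg_sub]
      rfl
    rw [h4, ← h3]
    congr 1
    exact Subtype.ext (congrArg Fm hsx.symm)
  have hin : ∀ v : 𝔼 3, 0 < ‖v‖ → ‖v‖ < 1 →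
      (OrientPosAt o₀ o k v ↔ ¬ OrientPosAt o₀ o gm (discInversionFun v)) := fun v hv0 hv1 => by
    have hev : k =ᶠ[𝓝 v] gm ∘ discInversionFun := by
      have hop : IsOpen {x : 𝔼 3 | 0 < ‖x‖ ∧ ‖x‖ < 1} := by
        rw [setOf_and]
        exact (isOpen_lt continuous_const continuous_norm).inter
          (isOpen_lt continuous_norm continuous_const)
      filter_upwards [hop.mem_nhds ⟨hv0, hv1⟩] with x hx
      exact hin_pt x hx.1 hx.2
    have hns : ‖discInversionFun v‖ = 1 - ‖v‖ := norm_discInversionFun (hne hv0) hv1.le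
    have hs0 : 0 < ‖discInversionFun v‖ := by rw [hns]; linarith
    have hs1 : ‖discInversionFun v‖ < 1 := by rw [hns]; linarith
    obtain ⟨g', -, hd⟩ := exists_hasFDerivAt_discInversionFun (n := 3) (hne hv0)
    have hdiff : DifferentiableAt ℝ (discInversionFun : 𝔼 3 → 𝔼 3) v := hd.differentiableAt
    have hgmd := hgmat _ hs0 hs1
    have hdet : LinearMap.det (M := 𝔼 3) (mfderiv 𝓘(ℝ, 𝔼 3) (𝓡 3) (gm ∘ discInversionFun) v).toLinearMap ≠ 0 := by
      rw [← hev.mfderiv_eq]; exact hkdet v ⟨hv0, by linarith⟩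
    obtain ⟨hdf, hdp⟩ := det_ne_zero_of_det_mfderiv_comp_ne_zero hdiff hgmd hdet
    rw [orientPosAt_congr_of_eventuallyEq hev, orientPosAt_comp_iff hdiff hgmd hdf hdp]
    have hneg := det_fderiv_discInversionFun_neg (n := 3) (by norm_num) hv0 hv1
    constructor
    · intro h h'
      exact absurd (h.1 h') (lt_asymm hneg)
    · intro h
      exact ⟨fun h' => absurd h' h, fun h' => absurd h' (lt_asymm hneg)⟩
  ------------------------------------------------------------------------------------------
  -- Step 4: conclusion
  ------------------------------------------------------------------------------------------
  -- an outer point over `w` and the inner point `ψ w'`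
  set v : 𝔼 3 := ((1 + ‖w‖) * ‖w‖⁻¹) • w with hv
  have hvn : ‖v‖ = 1 + ‖w‖ := by
    rw [hv, norm_smul, Real.norm_of_nonneg (mul_pos (by positivity) (inv_pos.2 hw0)).le]
    field_simp
  have hv1 : 1 < ‖v‖ := by rw [hvn]; linarith
  have hv2 : ‖v‖ < 2 := by rw [hvn]; linarith
  have hsv : shellShift v = w := shellShift_smul (hne hw0)
  set v' : 𝔼 3 := discInversionFun w' with hv'
  have hv'n : ‖v'‖ = 1 - ‖w'‖ := norm_discInversionFun (hne hw0') hw1'.le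
  have hv'0 : 0 < ‖v'‖ := by rw [hv'n]; linarith
  have hv'1 : ‖v'‖ < 1 := by rw [hv'n]; linarith
  have hsv' : discInversionFun v' = w' := discInversionFun_discInversionFun (hne hw0') hw1'
  rw [← hsv, ← hout v hv1 hv2, hkconst ⟨by linarith, hv2⟩ ⟨hv'0, by linarith⟩, hin v' hv'0 hv'1, hsv']

/-! ### §5 Two feet in one chart: the reflected framing has non-orientable result -/

/-- **The `0`-surgery along two feet lying in one chart, with framings of OPPOSITE Jacobian sign
in the chart coordinates and one of them precomposed with a reflection, is not orientable**
(Kosinski 1993, VI (6.6): the non-orientable `Dᵐ ∪ H¹`).  Concretely: `C : ℝ³ ↪ Z` a disc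
(e.g. the inverse of a chart onto `ℝ³`), `d₊, d₋ : ℝ³ → ℝ³` smooth with `det d(d₊) < 0 < det d(d₋)`
on the punctured unit ball, the punctured unit discs `d±(B̊¹ ∖ 0)` avoiding the two centres
`d₊ 0`, `d₋ 0`; `ρ` a linear isometry of `ℝ³` with `det ρ < 0`; `P` glued from the open
submanifold `A = Z ∖ {C (d₊ 0), C (d₋ 0)}` (embedding `jA`) and the neck `D̊¹ × S²` (embedding `jB`)
with `jA (C (d₊ (t u))) = jB (t e₁, u)` and `jA (C (d₋ (ρ (t u)))) = jB (-t e₁, u)` (`0 < t < 1`,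
`u ∈ S²`).  Then `P` carries no orientation: by `orientPosAt_foot_iff_not` the two feet
`C ∘ d₊`, `C ∘ d₋ ∘ ρ` would have opposite characters, but by the parity rule both are opposite to
the (constant, `ℝ³ ∖ {d₊ 0, d₋ 0}` being connected) character of `jA ∘ C`.
[cite: Kosinski1993, VI (6.6)] [cite: HirschDT1976, Ch. 4 §4, p. 101] -/
theorem not_smoothOrientation_of_reflected_foot (A : TopologicalSpace.Opens Z) {jA : A → P}
    (hA : Manifold.IsSmoothEmbedding (𝓡 3) (𝓡 3) ∞ jA) {jB : ↥(ballTimesSphere Unit 0 2) → P}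
    (hB : Manifold.IsSmoothEmbedding ((𝓡 0).prod ((𝓡 1).prod (𝓡 2))) (𝓡 3) ∞ jB)
    {C : 𝔼 3 → Z} (hC : Manifold.IsSmoothEmbedding 𝓘(ℝ, 𝔼 3) (𝓡 3) ∞ C)
    {dp dm : 𝔼 3 → 𝔼 3} (hdp : ContDiff ℝ ∞ dp) (hdm : ContDiff ℝ ∞ dm)
    (hdp' : ∀ w : 𝔼 3, 0 < ‖w‖ → ‖w‖ < 1 →
      LinearMap.det ((fderiv ℝ dp w : (𝔼 3) →L[ℝ] 𝔼 3) : (𝔼 3) →ₗ[ℝ] 𝔼 3) < 0)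
    (hdm' : ∀ w : 𝔼 3, 0 < ‖w‖ → ‖w‖ < 1 →
      0 < LinearMap.det ((fderiv ℝ dm w : (𝔼 3) →L[ℝ] 𝔼 3) : (𝔼 3) →ₗ[ℝ] 𝔼 3))
    (hp0 : ∀ w : 𝔼 3, 0 < ‖w‖ → ‖w‖ < 1 → dp w ≠ dp 0 ∧ dp w ≠ dm 0)
    (hm0 : ∀ w : 𝔼 3, 0 < ‖w‖ → ‖w‖ < 1 → dm w ≠ dp 0 ∧ dm w ≠ dm 0)
    (ρ : (𝔼 3) ≃ₗᵢ[ℝ] 𝔼 3)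
    (hρ : LinearMap.det (ρ.toLinearEquiv : (𝔼 3) →ₗ[ℝ] 𝔼 3) < 0)
    (hAC : ∀ z : Z, z ∈ A ↔ z ≠ C (dp 0) ∧ z ≠ C (dm 0))
    (hp : ∀ (t : ℝ) (_ : t ∈ Ioo (0 : ℝ) 1) (u : 𝕊 2) (ha : C (dp (t • (u : 𝔼 3))) ∈ A)
      (hb : ((DiscreteIndex.mk (), t • EuclideanSpace.single 0 1, u) :
        DiscreteIndex Unit × ((𝔼 1) × (𝕊 2))) ∈ ballTimesSphere Unit 0 2),
      jA ⟨C (dp (t • (u : 𝔼 3))), ha⟩ = jB ⟨_, hb⟩)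
    (hm : ∀ (t : ℝ) (_ : t ∈ Ioo (0 : ℝ) 1) (u : 𝕊 2) (ha : C (dm (ρ (t • (u : 𝔼 3)))) ∈ A)
      (hb : ((DiscreteIndex.mk (), (-t) • EuclideanSpace.single 0 1, u) :
        DiscreteIndex Unit × ((𝔼 1) × (𝕊 2))) ∈ ballTimesSphere Unit 0 2),
      jA ⟨C (dm (ρ (t • (u : 𝔼 3)))), ha⟩ = jB ⟨_, hb⟩)
    (o : SmoothOrientation (𝓡 3) P) : False := by
  -- a reference orientation of `ℝ³`, a filler point, a base point of the punctured unit ball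
  set o₀ : Orientation ℝ (𝔼 3) (Fin (finrank ℝ (𝔼 3))) := euclideanOrientation 3 with ho₀
  set p₀ : P := jB ⟨(DiscreteIndex.mk (), (0 : 𝔼 1), ⟨EuclideanSpace.single 0 1, by simp⟩), by simp⟩
    with hp₀
  set w₀ : 𝔼 3 := (2⁻¹ : ℝ) • EuclideanSpace.single 0 1 with hw₀
  have hw₀n : ‖w₀‖ = 2⁻¹ := by
    rw [hw₀, norm_smul, PiLp.norm_single, norm_one, mul_one, Real.norm_of_nonneg (by norm_num)]
  have hw₀0 : 0 < ‖w₀‖ := by rw [hw₀n]; norm_num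
  have hw₀1 : ‖w₀‖ < 1 := by rw [hw₀n]; norm_num
  have hne : ∀ {v : 𝔼 3}, 0 < ‖v‖ → v ≠ 0 := fun h => norm_pos_iff.1 h
  have hρn : ∀ v : 𝔼 3, ‖ρ v‖ = ‖v‖ := fun v => ρ.norm_map v
  have hCinj : Injective C := hC.isEmbedding.injective
  -- membership in `A` read in the chart
  have hmemA : ∀ {x : 𝔼 3}, C x ∈ A ↔ x ≠ dp 0 ∧ x ≠ dm 0 := fun {x} => by
    rw [hAC, hCinj.ne_iff, hCinj.ne_iff]
  ------------------------------------------------------------------------------------------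
  -- Step 1: the two feet have opposite characters (`orientPosAt_foot_iff_not`)
  ------------------------------------------------------------------------------------------
  have hU : IsOpen {x : 𝔼 3 | 0 < ‖x‖ ∧ ‖x‖ < 1} := by
    rw [setOf_and]
    exact (isOpen_lt continuous_const continuous_norm).inter (isOpen_lt continuous_norm continuous_const)
  have hFp : ContMDiffOn 𝓘(ℝ, 𝔼 3) (𝓡 3) ∞ (C ∘ dp) {w | 0 < ‖w‖ ∧ ‖w‖ < 1} :=
    (hC.contMDiff.comp hdp.contMDiff).contMDiffOn
  have hFm : ContMDiffOn 𝓘(ℝ, 𝔼 3) (𝓡 3) ∞ (C ∘ dm ∘ ρ) {w | 0 < ‖w‖ ∧ ‖w‖ < 1} :=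
    (hC.contMDiff.comp (hdm.contMDiff.comp ρ.toContinuousLinearEquiv.contDiff.contMDiff)).contMDiffOn
  have hFpA : ∀ w : 𝔼 3, 0 < ‖w‖ → ‖w‖ < 1 → (C ∘ dp) w ∈ A := fun w h0 h1 =>
    hmemA.2 (hp0 w h0 h1)
  have hFmA : ∀ w : 𝔼 3, 0 < ‖w‖ → ‖w‖ < 1 → (C ∘ dm ∘ ρ) w ∈ A := fun w h0 h1 =>
    hmemA.2 (hm0 (ρ w) (by rw [hρn]; exact h0) (by rw [hρn]; exact h1))
  have key := orientPosAt_foot_iff_not A hA hB hFp hFm hFpA hFmA hp hm o₀ o p₀ hw₀0 hw₀1 hw₀0 hw₀1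
  ------------------------------------------------------------------------------------------
  -- Step 2: the map `G = jA ∘ C` off the two centres; its character is constant
  ------------------------------------------------------------------------------------------
  set jAe : Z → P := Function.extend Subtype.val jA (fun _ => p₀) with hjAe
  set G : 𝔼 3 → P := jAe ∘ C with hG
  have hGsm : ∀ x : 𝔼 3, C x ∈ A → ContMDiffAt 𝓘(ℝ, 𝔼 3) (𝓡 3) ∞ G x := fun x hx =>
    (contMDiffAt_extend_val p₀ hA.contMDiff hx).comp x (hC.contMDiff x)
  have hGdet : ∀ x : 𝔼 3, C x ∈ A →
      LinearMap.det (M := 𝔼 3) (mfderiv 𝓘(ℝ, 𝔼 3) (𝓡 3) G x).toLinearMap ≠ 0 := fun x hx => by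
    rw [hG, mfderiv_comp x ((contMDiffAt_extend_val p₀ hA.contMDiff hx).mdifferentiableAt (by simp))
      ((hC.contMDiff x).mdifferentiableAt (by simp))]
    have hdet : LinearMap.det (M := 𝔼 3) ((mfderiv (𝓡 3) (𝓡 3) jAe (C x)).comp
        (mfderiv 𝓘(ℝ, 𝔼 3) (𝓡 3) C x)).toLinearMap =
        LinearMap.det (M := 𝔼 3) (mfderiv (𝓡 3) (𝓡 3) jAe (C x)).toLinearMap *
          LinearMap.det (M := 𝔼 3) (mfderiv 𝓘(ℝ, 𝔼 3) (𝓡 3) C x).toLinearMap :=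
      LinearMap.det_comp (M := 𝔼 3) _ _
    rw [hdet]
    exact mul_ne_zero (det_mfderiv_extend_val_ne_zero p₀ hA ⟨C x, hx⟩)
      (det_mfderiv_ne_zero_of_isImmersionAt (hC.isImmersion.isImmersionAt x))
  have hT : {x : 𝔼 3 | C x ∈ A} = ({dp 0, dm 0} : Set (𝔼 3))ᶜ := by
    ext x
    rw [mem_setOf_eq, hmemA, mem_compl_iff, mem_insert_iff, mem_singleton_iff, not_or]
  have hTo : IsOpen {x : 𝔼 3 | C x ∈ A} := by rw [hT]; exact (Set.toFinite _).isClosed.isOpen_compl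
  have hTc : IsPreconnected {x : 𝔼 3 | C x ∈ A} := by
    rw [hT]
    have hrank : 1 < Module.rank ℝ (𝔼 3) := by
      rw [← Module.finrank_eq_rank, finrank_euclideanSpace_fin]; norm_num
    exact ((Set.toFinite ({dp 0, dm 0} : Set (𝔼 3))).countable.isConnected_compl_of_one_lt_rank hrank).isPreconnected
  have hGon : ContMDiffOn 𝓘(ℝ, 𝔼 3) (𝓡 3) ∞ G {x | C x ∈ A} := fun x hx => (hGsm x hx).contMDiffWithinAt
  have hx₁ : C (dp w₀) ∈ A := hFpA w₀ hw₀0 hw₀1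
  have hx₂ : C (dm (ρ w₀)) ∈ A := hFmA w₀ hw₀0 hw₀1
  have hconst : OrientPosAt o₀ o G (dp w₀) ↔ OrientPosAt o₀ o G (dm (ρ w₀)) :=
    orientPosAt_iff_of_isPreconnected hTo hTc hGon hGdet hx₁ hx₂
  ------------------------------------------------------------------------------------------
  -- Step 3: parity — both feet have the character opposite to that of `G`
  ------------------------------------------------------------------------------------------
  have h₁ : OrientPosAt o₀ o (jAe ∘ (C ∘ dp)) w₀ ↔ ¬ OrientPosAt o₀ o G (dp w₀) := by
    have hd : LinearMap.det ((fderiv ℝ dp w₀ : (𝔼 3) →L[ℝ] 𝔼 3) : (𝔼 3) →ₗ[ℝ] 𝔼 3) < 0 :=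
      hdp' w₀ hw₀0 hw₀1
    rw [show jAe ∘ (C ∘ dp) = G ∘ dp from rfl,
      orientPosAt_comp_iff ((hdp.differentiable (by simp)) w₀)
        ((hGsm _ hx₁).mdifferentiableAt (by simp)) (hGdet _ hx₁) hd.ne]
    constructor
    · intro h h'; exact absurd (h.1 h') (lt_asymm hd)
    · intro h; exact ⟨fun h' => absurd h' h, fun h' => absurd h' (lt_asymm hd)⟩
  have h₂ : OrientPosAt o₀ o (jAe ∘ (C ∘ dm ∘ ρ)) w₀ ↔ ¬ OrientPosAt o₀ o G (dm (ρ w₀)) := by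
    -- `d(dm ∘ ρ) = d(dm) ∘ ρ` has negative determinant
    have hρd : HasFDerivAt (fun v : 𝔼 3 => ρ v) (ρ.toContinuousLinearEquiv : (𝔼 3) →L[ℝ] 𝔼 3) w₀ :=
      ρ.toContinuousLinearEquiv.hasFDerivAt
    have hdmd : HasFDerivAt dm (fderiv ℝ dm (ρ w₀)) (ρ w₀) :=
      ((hdm.differentiable (by simp)) (ρ w₀)).hasFDerivAt
    have hcomp : HasFDerivAt (dm ∘ ρ) ((fderiv ℝ dm (ρ w₀)).comp
        (ρ.toContinuousLinearEquiv : (𝔼 3) →L[ℝ] 𝔼 3)) w₀ := hdmd.comp w₀ hρd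
    have hd : LinearMap.det ((fderiv ℝ (dm ∘ ρ) w₀ : (𝔼 3) →L[ℝ] 𝔼 3) : (𝔼 3) →ₗ[ℝ] 𝔼 3) < 0 := by
      rw [hcomp.fderiv]
      have e : (((fderiv ℝ dm (ρ w₀)).comp (ρ.toContinuousLinearEquiv : (𝔼 3) →L[ℝ] 𝔼 3) :
          (𝔼 3) →L[ℝ] 𝔼 3) : (𝔼 3) →ₗ[ℝ] 𝔼 3) =
          ((fderiv ℝ dm (ρ w₀) : (𝔼 3) →L[ℝ] 𝔼 3) : (𝔼 3) →ₗ[ℝ] 𝔼 3) ∘ₗ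
            (ρ.toLinearEquiv : (𝔼 3) →ₗ[ℝ] 𝔼 3) := rfl
      rw [e, LinearMap.det_comp]
      exact mul_neg_of_pos_of_neg (hdm' (ρ w₀) (by rw [hρn]; exact hw₀0) (by rw [hρn]; exact hw₀1)) hρ
    rw [show jAe ∘ (C ∘ dm ∘ ρ) = G ∘ (dm ∘ ρ) from rfl,
      orientPosAt_comp_iff hcomp.differentiableAt ((hGsm _ hx₂).mdifferentiableAt (by simp))
        (hGdet _ hx₂) hd.ne]
    constructor
    · intro h h'; exact absurd (h.1 h') (lt_asymm hd)
    · intro h; exact ⟨fun h' => absurd h' h, fun h' => absurd h' (lt_asymm hd)⟩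
  rw [h₁, h₂, hconst] at key
  exact iff_not_self (not_not.symm.trans key.symm)

end ZeroSphereOrientation

end Literature.Topology.FourManifolds

end
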